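import Summits.ABC.ABC.Theorems.DeepRegimeABC.Negative.WithoutEps

/-!
# `DeepRegimeABC` (stmt-ABC-15121): the pair `(K, C)` must depend on `ε`

Negative-side support lemmas for the crux `Summit.ABC.ABC.Theses.IneffectiveSubspace.DeepRegimeABC`
(`∀ ε > 0 ∃ K C, abc with exponent 1 + ε and constant C on the cell {ω₅(abc) ≥ K}`), from the crux
disprover's work file `Cruxes/DeepRegimeABC/Disproof.lean` §(b) (2026-08-16).  The crux is equivalent
to its constant-free form (`C = 1`, `Theorems/IneffectiveSubspaceDeepRegimeABCNormalForms.lean`); here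
we record that the remaining parameter, the depth threshold, is genuinely `ε`-dependent:

* `deepRegimeABC_not_uniform_in_eps` — the quantifiers cannot be commuted to `∃ K C ∀ ε`: on every
  cell and for every `C` there is an abc triple with `C·rad(abc) < c` (`deepCell_no_uniform_constant`,
  Granville–Tucker inside the cell), and `ε → 0⁺` in `c < C·rad^(1+ε)` would give `c ≤ C·rad`.
* `deepRegimeABC_constFree_threshold_unbounded` — in the constant-free form NO single cell serves all
  `ε`: the threshold function `K₁(ε)` tends to infinity as `ε → 0⁺` (explicit floors:
  `Negative/ConstFreeFloors.lean`).
* `omegaTail_not_uniform_in_eps` — the same for the `ω`-tail form of the crux (the line's stub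
  `stub_omegaTailABC`, `{ω(abc) ≥ W} ⊇ {ω₅(abc) ≥ W}`).

Contrast (not refutable, recorded for provers): with a constant `C(ε)` the uniform-threshold form
`∃ K₀ ∀ ε ∃ C` is abc on a FIXED deep cell, which is abc-complete by quintic breeding — i.e. `ABC`.
-/

-- `Summit.<Summit>.<Problem>` is the mandated summit-side namespace (CONVENTIONS §2); for the
-- single-conjunct summit `ABC` the two coincide, so the duplicate `ABC.ABC` is deliberate.
set_option linter.dupNamespace false

namespace Summit.ABC.ABC.Theorems.DeepRegimeABC.Negative

open Literature.NumberTheory.DiophantineGeometry UniqueFactorizationMonoid Filter Topology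

/-- **`∀ ε ∃ K C` cannot be commuted to `∃ K C ∀ ε`.** There are no `K`, `C` such that
`c < C·rad(abc)^(1+ε)` holds for every `ε > 0` and every abc triple with `ω₅(abc) ≥ K`
(limit `ε → 0⁺` against `deepCell_no_uniform_constant`). [cite: GranvilleTucker2002, p. 1227] -/
theorem deepRegimeABC_not_uniform_in_eps :
    ¬ ∃ K : ℕ, ∃ C : ℝ, ∀ ε : ℝ, 0 < ε → ∀ a b c : ℕ, IsABCTriple a b c →
        K ≤ ((a * b * c).primeFactors.filter (fun p => 5 ≤ (a * b * c).factorization p)).card →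
        (c : ℝ) < C * ((rad a b c : ℕ) : ℝ) ^ (1 + ε) := by
  rintro ⟨K, C, h⟩
  obtain ⟨a, b, c, habc, hK, hlt⟩ := deepCell_no_uniform_constant K C
  set r : ℝ := ((rad a b c : ℕ) : ℝ) with hr_def
  have hr : 0 < r := by
    rw [hr_def, rad_def]; exact_mod_cast Nat.radical_pos _
  have hcont : Tendsto (fun ε : ℝ => C * r ^ (1 + ε)) (𝓝[>] 0) (𝓝 (C * r)) := by
    have hc : Continuous (fun ε : ℝ => C * r ^ (1 + ε)) :=
      continuous_const.mul (continuous_const.rpow (continuous_const.add continuous_id)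
        (fun _ => Or.inl hr.ne'))
    have := (hc.tendsto 0).mono_left (nhdsWithin_le_nhds (s := Set.Ioi (0 : ℝ)))
    simpa using this
  have hev : ∀ᶠ ε in 𝓝[>] (0 : ℝ), (c : ℝ) ≤ C * r ^ (1 + ε) :=
    eventually_nhdsWithin_of_forall fun ε hε => (h ε hε a b c habc hK).le
  have hle : (c : ℝ) ≤ C * r := ge_of_tendsto hcont hev
  exact absurd hle (not_le.mpr hlt)

/-- **In the constant-free normal form the threshold is unbounded**: no single cell `{ω₅ ≥ K}`
carries `c < rad(abc)^(1+ε)` for every `ε > 0`; the threshold `K₁(ε)` of the `C = 1` form tends to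
infinity as `ε → 0⁺`. [cite: GranvilleTucker2002, p. 1227] -/
theorem deepRegimeABC_constFree_threshold_unbounded :
    ¬ ∃ K : ℕ, ∀ ε : ℝ, 0 < ε → ∀ a b c : ℕ, IsABCTriple a b c →
        K ≤ ((a * b * c).primeFactors.filter (fun p => 5 ≤ (a * b * c).factorization p)).card →
        (c : ℝ) < ((rad a b c : ℕ) : ℝ) ^ (1 + ε) := by
  rintro ⟨K, h⟩
  exact deepRegimeABC_not_uniform_in_eps ⟨K, 1, fun ε hε a b c habc hK => by
    simpa using h ε hε a b c habc hK⟩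

/-- **The `ω`-tail stub is not uniform in `ε` either**: no `W`, `C` give `c < C·rad(abc)^(1+ε)` for
every `ε > 0` on the many-primes tail `{ω(abc) ≥ W}` (it contains the deep cell `{ω₅(abc) ≥ W}`).
[cite: GranvilleTucker2002, p. 1227] -/
theorem omegaTail_not_uniform_in_eps :
    ¬ ∃ W : ℕ, ∃ C : ℝ, ∀ ε : ℝ, 0 < ε → ∀ a b c : ℕ, IsABCTriple a b c →
        W ≤ (a * b * c).primeFactors.card → (c : ℝ) < C * ((rad a b c : ℕ) : ℝ) ^ (1 + ε) := by
  rintro ⟨W, C, h⟩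
  exact deepRegimeABC_not_uniform_in_eps
    ⟨W, C, fun ε hε a b c habc hK => h ε hε a b c habc (hK.trans (Finset.card_filter_le _ _))⟩

end Summit.ABC.ABC.Theorems.DeepRegimeABC.Negative
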